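import Literature.NumberTheory.Rogawski1990.ArchLimitFormulaNoncompactWallConstUnique  -- ★ p841778 (R1-d″)(a): uniqueness of the (J-nc) constant; brings ★ p840202 the letter
import Literature.NumberTheory.Automorphic.ArchLocalTorusFixingCongruence        -- FILE A (this brick): the torus-fixing congruence `e_T`, the rescaling `D`
import Literature.NumberTheory.Automorphic.OrbitalIntegralCentralTransport     -- ★ `integral_descConj_quotientMeasure_eq_of_mulEquiv`, `subgroupCongrHomeomorph`, `forall_apply_mem_centralizer_singleton_iff_of_eq`
import HarnessLib

/-!
# (R1-d)(b2′) The (J-nc) constant is TRANSPORTED ACROSS THE TWO NONCOMPACT WALL CLASSES along a torus-fixing congruence — in particular along the diagonal RESCALING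
# `D = diag(√(α₀∕α₁), √(α₁∕α₀), 1)`, `U(σ_w diag α) ≃ U(σ_w diag(α ∘ (0 1)))` (ROAD-Sd R1 «COHERENCE ∕ TRANSPORT», cross-wall half; Rogawski 1990 §8.2 pp. 119, 122–124, §8.4 pp. 126–127)

Topic `NumberTheory/Rogawski1990`; namespace `Literature.NumberTheory.Rogawski1990`.  THEOREMS ONLY (no definition, no instance, no notation, no named fact, no `sorry`).
Cell `pub/hodgecm-mathlib`, ENGINE T1 (crux H413 = `stmt-HodgeConjecture-24833`); ROAD-Sd residual R1, brick (R1-d)(b2′) (LEAD F0P3a-plan (g9) WORDS T8-106 → T8-111 «CUT … NOW»,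
replacing the booked letter `hXwall` of T8-93; consumer F0P3-p03 (g9)'s (R1-h) END-STATE SIGNED REGROUPING; twin of F0P3-p03's (b1) ★ `ArchLimitFormulaNoncompactWallConstTransport`
(within-class transport along the relabelling `(0 2)`)); author F0P3a-p02 (g11), 2026-09-01.

WHY.  At a complex place `w` where `U(σ_w diag α) ≅ U(2,1)` has TWO noncompact walls — the coalescing pairs `{α₀, α₂}` and `{α₁, α₂}` both span indefinite planes, i.e.
`re σα₀·re σα₂ < 0` and `re σα₁·re σα₂ < 0`, hence `re σα₀ ∕ re σα₁ > 0` — the letter ★ `ArchLimitFormulaNoncompactWall` produces ONE constant per wall class (read on the frames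
`α∘τ` whose `{0,2}`-wall is that class).  F0P3-p03's (b1) connects `τ` and `τ∘(0 2)` (same class).  The two CLASSES are connected by a congruence that is NOT a relabelling: the
diagonal rescaling `D = diag(√(re σα₀∕re σα₁), √(re σα₁∕re σα₀), 1)` satisfies `Dᴴ·σ_w diag(α∘(0 1))·D = σ_w diag α`, so `Ad(D) : U(σ_w diag α) ≃ₜ* U(σ_w diag(α∘(0 1)))`
(★ `conj_mem_unitaryGroupOfForm_iff`, ★ `GLn.conjEquiv`), and being DIAGONAL it FIXES THE CIRCLE TORUS POINTWISE (`D·diag z·D⁻¹ = diag z`): it carries the standard `{0,2}`-wall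
curve `ψ ↦ diag(z₀₀e^{iψ}, z₀₁, z₀₀e^{−iψ})` of `G_w(α)` (class `{α₀,α₂}`) to the SAME curve of `G_w(α∘(0 1))`, whose `{0,2}`-wall is the class `{α₁,α₂}`.  Transporting the letter's
clause along `Ad(D)` (test function `Θ ↦ Θ(D · D⁻¹)`, `ν ↦ Ad(D)_*ν`, `ν_H ↦ Ad(D)_*ν_H` on `Z(diag z₁) ↦ Z(diag z₁)`; the singular side by ★ `integral_descConj_quotientMeasure_eq_of_mulEquiv`)
yields the clause on the target frame with the SAME constant; ★ p841778's uniqueness then equates the two class constants for COHERENTLY TRANSPORTED centraliser measures.  With (b1) every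
two noncompact relabellings at `w` are connected, so «`∀ nc τ, c_w(τ) = C_w`» is a THEOREM and the only printed residue of (R1-d) is the VALUE of `C_w` ((J-val), parked).
At a place with exactly ONE noncompact wall class the hypothesis `0 < re σα₀ · re σα₁` of §4 fails and nothing is claimed (nor needed: one class, (b1) suffices).

WHAT IS PROVED (FILE B; the congruence algebra `e_T`, `D` is FILE A ★ `Automorphic/ArchLocalTorusFixingCongruence`).
§2 (`N = 3`, any field) **`archLimitFormulaNoncompactWall_clause_transport_of_torusFixing`** — the letter's conclusion CLAUSE for `(α; ν, z₁, ν_H, c)` ⟹ the CLAUSE for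
   `(α′; e_T_*ν, z₁, (e_T|_Z)_*ν_H, c)` with the SAME `c`.
§3 (CM `L`) **`archLimitFormulaNoncompactWall_const_eq_of_transport_of_torusFixing`** — clause for `c₁` on `G_w(α′)` at the transported datum + clause for `c₂` on `G_w(α)` ⟹ `c₁ = c₂`
   (§2 + ★ p841778 `archLimitFormulaNoncompactWall_const_unique`).
USE (the cross-wall equality, consumer F0P3-p03 (g9)'s (R1-h)): §3 at `T := D`, `α′ := α ∘ (0 1)` with `hcongr := formCongr_rescale01_map_diagonal L α w hreal h01` and
   `htorus := rescale01_conj_circleDiagonal L α w h01` (FILE A) equates the constants of the classes `{α₀,α₂}` (frame `α`) and `{α₁,α₂}` (frame `α∘(0 1)`) for transported `(ν, ν_H)`;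
   with F0P3-p03's (b1) (`τ ↦ τ∘(0 2)`) every two noncompact relabellings at `w` are connected.
HONEST LABEL: HC_CM is proved only modulo the printed citations until rung 0 closes; this file is transport bookkeeping over ★ p840202 ∕ ★ p841778 and pays nothing by itself.

## References
* [Rogawski1990] J. D. Rogawski, *Automorphic Representations of Unitary Groups in Three Variables*, Ann. of Math. Stud. 123 (1990), §8.2 pp. 119, 122–124 (the constant `c` of the
  limit formula «lim ∂_ψ g(ψ) = c f^H(γ₀)», the classes `γ, γ₁, γ₂`), §8.4 pp. 126–127 (the limit formulas on `U(2,1)`), §3.7 Prop. 3.7.1 (conjugacy of tori).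
* [Varadarajan1989] V. S. Varadarajan, *An Introduction to Harmonic Analysis on Semisimple Lie Groups* (1989), §6.4 Thm 22.
* [PlatonovRapinchuk1994] V. Platonov, A. Rapinchuk, *Algebraic Groups and Number Theory* (1994), §2.3 (congruent hermitian forms have conjugate unitary groups).
* [DeitmarEchterhoff2014] A. Deitmar, S. Echterhoff, *Principles of Harmonic Analysis*, 2nd ed. (2014), Thm. 1.5.3.
-/

set_option autoImplicit false

noncomputable section

open MeasureTheory Measure Filter Topology NumberField NumberField.InfinitePlace Matrix Equiv
open Literature.MeasureTheory.Group Literature.NumberTheory.Automorphic Literature.NumberTheory.Automorphic.UnitaryGroup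
open scoped Matrix MatrixGroups Matrix.Norms.Operator ComplexConjugate

/-! ## §2 The (J-nc) clause is transported along a torus-fixing congruence -/

namespace Literature.NumberTheory.Rogawski1990

section Transport

variable (L : Type) [Field L] (α α' : Fin 3 → L) (w : {w : InfinitePlace L // IsComplex w}) (T : GL (Fin 3) ℂ)
  (hcongr : formCongr (starRingEnd ℂ) T ((Matrix.diagonal α').map w.1.embedding) = (Matrix.diagonal α).map w.1.embedding)
  (htorus : ∀ z : Fin 3 → Circle, T * circleDiagonal 3 z * T⁻¹ = circleDiagonal 3 z)

include htorus in
/-- **(R1-d)(b2′) THE (J-nc) CLAUSE IS TRANSPORTED ALONG A TORUS-FIXING CONGRUENCE.**  If `c` satisfies the conclusion clause of ★ `ArchLimitFormulaNoncompactWall` on `G_w(α)` for the datum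
`(ν, z₁, ν_H)`, then the SAME `c` satisfies it on `G_w(α′)` for the transported datum `(ν′ = e_T_*ν, z₁, ν_H′ = (e_T|_Z)_*ν_H)` — `e_T` FIXES every torus point, so the standard
`{0,2}`-wall curve of `G_w(α)` IS the standard curve of `G_w(α′)` (no `ψ ↦ −ψ` twist, unlike the relabelling (b1)).  Proof: test the source clause with `Θ′ = Θ(T·T⁻¹)` at the SAME
`z₀`; the target torus integral is the source one (§1); the singular side by ★ `integral_descConj_quotientMeasure_eq_of_mulEquiv`. [cite: Rogawski1990, §8.2 pp. 119, 122–124; §8.4 pp. 126–127]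
[cite: Varadarajan1989, §6.4 Thm 22] [cite: DeitmarEchterhoff2014, Thm. 1.5.3] -/
theorem archLimitFormulaNoncompactWall_clause_transport_of_torusFixing
    [LocallyCompactSpace (archLocal L 3 (Matrix.diagonal α) w)] [SecondCountableTopology (archLocal L 3 (Matrix.diagonal α) w)] [MeasurableSpace (archLocal L 3 (Matrix.diagonal α) w)] [BorelSpace (archLocal L 3 (Matrix.diagonal α) w)]
    [LocallyCompactSpace (archLocal L 3 (Matrix.diagonal α') w)] [SecondCountableTopology (archLocal L 3 (Matrix.diagonal α') w)] [MeasurableSpace (archLocal L 3 (Matrix.diagonal α') w)] [BorelSpace (archLocal L 3 (Matrix.diagonal α') w)]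
    (ν : Measure (archLocal L 3 (Matrix.diagonal α) w)) [ν.IsHaarMeasure] [ν.IsMulRightInvariant]
    (ν' : Measure (archLocal L 3 (Matrix.diagonal α') w)) [ν'.IsHaarMeasure] [ν'.IsMulRightInvariant]
    (hν' : ν' = ν.map (ContinuousMulEquiv.restrictSubgroup (GLn.conjEquiv T) (archLocal L 3 (Matrix.diagonal α) w) (archLocal L 3 (Matrix.diagonal α') w)
        (mem_archLocal_diagonal_iff_conjEquiv_mem_of_formCongr_eq L 3 α α' w T hcongr)))
    (z₁ : Fin 3 → Circle) (h02 : z₁ 0 = z₁ 2) (h01 : z₁ 0 ≠ z₁ 1)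
    (νH : Measure (Subgroup.centralizer ({(⟨circleDiagonal 3 z₁, circleDiagonal_mem_archLocal_diagonal L 3 α w z₁⟩ : archLocal L 3 (Matrix.diagonal α) w)} : Set (archLocal L 3 (Matrix.diagonal α) w)))) [νH.IsHaarMeasure] [νH.IsInvInvariant]
    (νH' : Measure (Subgroup.centralizer ({(⟨circleDiagonal 3 z₁, circleDiagonal_mem_archLocal_diagonal L 3 α' w z₁⟩ : archLocal L 3 (Matrix.diagonal α') w)} : Set (archLocal L 3 (Matrix.diagonal α') w)))) [νH'.IsHaarMeasure] [νH'.IsInvInvariant]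
    (hνH' : νH' = νH.map (subgroupCongrHomeomorph (ContinuousMulEquiv.restrictSubgroup (GLn.conjEquiv T) (archLocal L 3 (Matrix.diagonal α) w) (archLocal L 3 (Matrix.diagonal α') w)
        (mem_archLocal_diagonal_iff_conjEquiv_mem_of_formCongr_eq L 3 α α' w T hcongr)).toMulEquiv
      (Subgroup.centralizer ({(⟨circleDiagonal 3 z₁, circleDiagonal_mem_archLocal_diagonal L 3 α w z₁⟩ : archLocal L 3 (Matrix.diagonal α) w)} : Set (archLocal L 3 (Matrix.diagonal α) w)))
      (Subgroup.centralizer ({(⟨circleDiagonal 3 z₁, circleDiagonal_mem_archLocal_diagonal L 3 α' w z₁⟩ : archLocal L 3 (Matrix.diagonal α') w)} : Set (archLocal L 3 (Matrix.diagonal α') w)))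
      (forall_apply_mem_centralizer_singleton_iff_of_eq (ContinuousMulEquiv.restrictSubgroup (GLn.conjEquiv T) (archLocal L 3 (Matrix.diagonal α) w) (archLocal L 3 (Matrix.diagonal α') w)
        (mem_archLocal_diagonal_iff_conjEquiv_mem_of_formCongr_eq L 3 α α' w T hcongr)).toMulEquiv (congrT_circleDiagonal L 3 α α' w T hcongr htorus z₁))
      (ContinuousMulEquiv.restrictSubgroup (GLn.conjEquiv T) (archLocal L 3 (Matrix.diagonal α) w) (archLocal L 3 (Matrix.diagonal α') w)
        (mem_archLocal_diagonal_iff_conjEquiv_mem_of_formCongr_eq L 3 α α' w T hcongr)).continuous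
      (ContinuousMulEquiv.restrictSubgroup (GLn.conjEquiv T) (archLocal L 3 (Matrix.diagonal α) w) (archLocal L 3 (Matrix.diagonal α') w)
        (mem_archLocal_diagonal_iff_conjEquiv_mem_of_formCongr_eq L 3 α α' w T hcongr)).symm.continuous))
    [MeasurableSpace (archLocal L 3 (Matrix.diagonal α) w ⧸ Subgroup.centralizer ({(⟨circleDiagonal 3 z₁, circleDiagonal_mem_archLocal_diagonal L 3 α w z₁⟩ : archLocal L 3 (Matrix.diagonal α) w)} : Set (archLocal L 3 (Matrix.diagonal α) w)))]
    [BorelSpace (archLocal L 3 (Matrix.diagonal α) w ⧸ Subgroup.centralizer ({(⟨circleDiagonal 3 z₁, circleDiagonal_mem_archLocal_diagonal L 3 α w z₁⟩ : archLocal L 3 (Matrix.diagonal α) w)} : Set (archLocal L 3 (Matrix.diagonal α) w)))]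
    [MeasurableSpace (archLocal L 3 (Matrix.diagonal α') w ⧸ Subgroup.centralizer ({(⟨circleDiagonal 3 z₁, circleDiagonal_mem_archLocal_diagonal L 3 α' w z₁⟩ : archLocal L 3 (Matrix.diagonal α') w)} : Set (archLocal L 3 (Matrix.diagonal α') w)))]
    [BorelSpace (archLocal L 3 (Matrix.diagonal α') w ⧸ Subgroup.centralizer ({(⟨circleDiagonal 3 z₁, circleDiagonal_mem_archLocal_diagonal L 3 α' w z₁⟩ : archLocal L 3 (Matrix.diagonal α') w)} : Set (archLocal L 3 (Matrix.diagonal α') w)))]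
    (c : ℂ)
    (hc : ∀ (Θ : Matrix (Fin 3) (Fin 3) ℂ → ℂ), ContDiff ℝ (⊤ : ℕ∞) Θ →
        HasCompactSupport (fun k : archLocal L 3 (Matrix.diagonal α) w => Θ ((k : GL (Fin 3) ℂ) : Matrix (Fin 3) (Fin 3) ℂ)) →
        ∀ (z₀ : Fin 3 → Circle) (h02' : z₀ 0 = z₀ 2) (h01' : z₀ 0 ≠ z₀ 1),
          Tendsto (fun ψ : ℝ => deriv (fun ψ : ℝ => (2 * Real.sin ψ : ℂ) *
              ∫ g, Θ (((g * ⟨circleDiagonal 3 (fun i => z₀ i * Circle.exp (![(1 : ℝ), 0, -1] i * ψ)),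
                circleDiagonal_mem_archLocal_diagonal L 3 α w _⟩ * g⁻¹ : archLocal L 3 (Matrix.diagonal α) w) : GL (Fin 3) ℂ) : Matrix (Fin 3) (Fin 3) ℂ) ∂ν) ψ)
            (𝓝[≠] 0)
            (𝓝 (c * ∫ y, descConj (⟨circleDiagonal 3 z₀, circleDiagonal_mem_archLocal_diagonal L 3 α w z₀⟩ : archLocal L 3 (Matrix.diagonal α) w)
              (Subgroup.centralizer ({(⟨circleDiagonal 3 z₁, circleDiagonal_mem_archLocal_diagonal L 3 α w z₁⟩ : archLocal L 3 (Matrix.diagonal α) w)} : Set (archLocal L 3 (Matrix.diagonal α) w)))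
              (forall_mem_centralizer_circleDiagonal_comm_of_wall L α w h02 h01 h02' h01')
              (fun k : archLocal L 3 (Matrix.diagonal α) w => Θ ((k : GL (Fin 3) ℂ) : Matrix (Fin 3) (Fin 3) ℂ)) y
              ∂(quotientMeasure _ νH (isClosed_coe_centralizer_singleton _) ν)))) :
    ∀ (Θ : Matrix (Fin 3) (Fin 3) ℂ → ℂ), ContDiff ℝ (⊤ : ℕ∞) Θ →
        HasCompactSupport (fun k : archLocal L 3 (Matrix.diagonal α') w => Θ ((k : GL (Fin 3) ℂ) : Matrix (Fin 3) (Fin 3) ℂ)) →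
        ∀ (z₀ : Fin 3 → Circle) (h02' : z₀ 0 = z₀ 2) (h01' : z₀ 0 ≠ z₀ 1),
          Tendsto (fun ψ : ℝ => deriv (fun ψ : ℝ => (2 * Real.sin ψ : ℂ) *
              ∫ g, Θ (((g * ⟨circleDiagonal 3 (fun i => z₀ i * Circle.exp (![(1 : ℝ), 0, -1] i * ψ)),
                circleDiagonal_mem_archLocal_diagonal L 3 α' w _⟩ * g⁻¹ : archLocal L 3 (Matrix.diagonal α') w) : GL (Fin 3) ℂ) : Matrix (Fin 3) (Fin 3) ℂ) ∂ν') ψ)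
            (𝓝[≠] 0)
            (𝓝 (c * ∫ y, descConj (⟨circleDiagonal 3 z₀, circleDiagonal_mem_archLocal_diagonal L 3 α' w z₀⟩ : archLocal L 3 (Matrix.diagonal α') w)
              (Subgroup.centralizer ({(⟨circleDiagonal 3 z₁, circleDiagonal_mem_archLocal_diagonal L 3 α' w z₁⟩ : archLocal L 3 (Matrix.diagonal α') w)} : Set (archLocal L 3 (Matrix.diagonal α') w)))
              (forall_mem_centralizer_circleDiagonal_comm_of_wall L α' w h02 h01 h02' h01')
              (fun k : archLocal L 3 (Matrix.diagonal α') w => Θ ((k : GL (Fin 3) ℂ) : Matrix (Fin 3) (Fin 3) ℂ)) y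
              ∂(quotientMeasure _ νH' (isClosed_coe_centralizer_singleton _) ν'))) := by
  intro Θ hΘ hΘc z₀ h02' h01'
  set e := (ContinuousMulEquiv.restrictSubgroup (GLn.conjEquiv T) (archLocal L 3 (Matrix.diagonal α) w) (archLocal L 3 (Matrix.diagonal α') w)
        (mem_archLocal_diagonal_iff_conjEquiv_mem_of_formCongr_eq L 3 α α' w T hcongr)) with he_def
  -- the source clause tested with `Θ′ = Θ(T·T⁻¹)` at the SAME `z₀`
  have hΘ' := contDiff_comp_units_conj (N := 3) T Θ hΘ
  have hΘ'c := hasCompactSupport_comp_congrT L 3 α α' w T hcongr Θ hΘc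
  have key := hc _ hΘ' hΘ'c z₀ h02' h01'
  -- (1) the target torus integral at `ψ` IS the source one at `ψ` (the torus point is fixed by `e_T`)
  have hF : ∀ ψ : ℝ,
      ∫ g, Θ (((g * ⟨circleDiagonal 3 (fun i => z₀ i * Circle.exp (![(1 : ℝ), 0, -1] i * ψ)),
                circleDiagonal_mem_archLocal_diagonal L 3 α' w _⟩ * g⁻¹ : archLocal L 3 (Matrix.diagonal α') w) : GL (Fin 3) ℂ) : Matrix (Fin 3) (Fin 3) ℂ) ∂ν' =
        ∫ g, (fun A : Matrix (Fin 3) (Fin 3) ℂ => Θ ((T : Matrix (Fin 3) (Fin 3) ℂ) * A * ((T⁻¹ : GL (Fin 3) ℂ) : Matrix (Fin 3) (Fin 3) ℂ)))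
          (((g * ⟨circleDiagonal 3 (fun i => z₀ i * Circle.exp (![(1 : ℝ), 0, -1] i * ψ)),
                circleDiagonal_mem_archLocal_diagonal L 3 α w _⟩ * g⁻¹ : archLocal L 3 (Matrix.diagonal α) w) : GL (Fin 3) ℂ) : Matrix (Fin 3) (Fin 3) ℂ) ∂ν := by
    intro ψ
    rw [hν', integral_comp_conj_circleDiagonal_eq_integral_map_congrT L 3 α α' w T hcongr htorus ν
      (fun k : archLocal L 3 (Matrix.diagonal α') w => Θ ((k : GL (Fin 3) ℂ) : Matrix (Fin 3) (Fin 3) ℂ))]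
    refine integral_congr_ae (Filter.Eventually.of_forall fun g => ?_)
    exact apply_coe_congrT L 3 α α' w T hcongr Θ _
  have hfun : (fun ψ : ℝ => deriv (fun ψ : ℝ => (2 * Real.sin ψ : ℂ) *
      ∫ g, Θ (((g * ⟨circleDiagonal 3 (fun i => z₀ i * Circle.exp (![(1 : ℝ), 0, -1] i * ψ)),
                circleDiagonal_mem_archLocal_diagonal L 3 α' w _⟩ * g⁻¹ : archLocal L 3 (Matrix.diagonal α') w) : GL (Fin 3) ℂ) : Matrix (Fin 3) (Fin 3) ℂ) ∂ν') ψ) =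
      fun ψ : ℝ => deriv (fun ψ : ℝ => (2 * Real.sin ψ : ℂ) *
        ∫ g, (fun A : Matrix (Fin 3) (Fin 3) ℂ => Θ ((T : Matrix (Fin 3) (Fin 3) ℂ) * A * ((T⁻¹ : GL (Fin 3) ℂ) : Matrix (Fin 3) (Fin 3) ℂ)))
          (((g * ⟨circleDiagonal 3 (fun i => z₀ i * Circle.exp (![(1 : ℝ), 0, -1] i * ψ)),
                circleDiagonal_mem_archLocal_diagonal L 3 α w _⟩ * g⁻¹ : archLocal L 3 (Matrix.diagonal α) w) : GL (Fin 3) ℂ) : Matrix (Fin 3) (Fin 3) ℂ) ∂ν) ψ := by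
    funext ψ
    simp only [hF]
  rw [hfun]
  -- (2) the singular orbital integral is carried by `e_T` (which fixes `diag z₀`)
  haveI : IsClosed ((Subgroup.centralizer ({(⟨circleDiagonal 3 z₁, circleDiagonal_mem_archLocal_diagonal L 3 α w z₁⟩ : archLocal L 3 (Matrix.diagonal α) w)} : Set (archLocal L 3 (Matrix.diagonal α) w)) : Subgroup (archLocal L 3 (Matrix.diagonal α) w)) : Set (archLocal L 3 (Matrix.diagonal α) w)) := isClosed_coe_centralizer_singleton _
  haveI : IsClosed ((Subgroup.centralizer ({(⟨circleDiagonal 3 z₁, circleDiagonal_mem_archLocal_diagonal L 3 α' w z₁⟩ : archLocal L 3 (Matrix.diagonal α') w)} : Set (archLocal L 3 (Matrix.diagonal α') w)) : Subgroup (archLocal L 3 (Matrix.diagonal α') w)) : Set (archLocal L 3 (Matrix.diagonal α') w)) := isClosed_coe_centralizer_singleton _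
  have hγ₀ : e.toMulEquiv (⟨circleDiagonal 3 z₀, circleDiagonal_mem_archLocal_diagonal L 3 α w z₀⟩ : archLocal L 3 (Matrix.diagonal α) w) =
      (⟨circleDiagonal 3 z₀, circleDiagonal_mem_archLocal_diagonal L 3 α' w z₀⟩ : archLocal L 3 (Matrix.diagonal α') w) := by
    show e _ = _
    rw [he_def, congrT_circleDiagonal L 3 α α' w T hcongr htorus]
  have hI := integral_descConj_quotientMeasure_eq_of_mulEquiv e.toMulEquiv e.continuous e.symm.continuous
    (Subgroup.centralizer ({(⟨circleDiagonal 3 z₁, circleDiagonal_mem_archLocal_diagonal L 3 α w z₁⟩ : archLocal L 3 (Matrix.diagonal α) w)} : Set (archLocal L 3 (Matrix.diagonal α) w)))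
    (Subgroup.centralizer ({(⟨circleDiagonal 3 z₁, circleDiagonal_mem_archLocal_diagonal L 3 α' w z₁⟩ : archLocal L 3 (Matrix.diagonal α') w)} : Set (archLocal L 3 (Matrix.diagonal α') w)))
    (forall_apply_mem_centralizer_singleton_iff_of_eq e.toMulEquiv (congrT_circleDiagonal L 3 α α' w T hcongr htorus z₁))
    νH νH' ν ν' hνH' hν' hγ₀
    (forall_mem_centralizer_circleDiagonal_comm_of_wall L α w h02 h01 h02' h01')
    (forall_mem_centralizer_circleDiagonal_comm_of_wall L α' w h02 h01 h02' h01')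
    (fun k : archLocal L 3 (Matrix.diagonal α') w => Θ ((k : GL (Fin 3) ℂ) : Matrix (Fin 3) (Fin 3) ℂ))
  have hcomp : ((fun k : archLocal L 3 (Matrix.diagonal α') w => Θ ((k : GL (Fin 3) ℂ) : Matrix (Fin 3) (Fin 3) ℂ)) ∘ e.toMulEquiv) =
      fun k : archLocal L 3 (Matrix.diagonal α) w => (fun A : Matrix (Fin 3) (Fin 3) ℂ => Θ ((T : Matrix (Fin 3) (Fin 3) ℂ) * A * ((T⁻¹ : GL (Fin 3) ℂ) : Matrix (Fin 3) (Fin 3) ℂ)))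
        ((k : GL (Fin 3) ℂ) : Matrix (Fin 3) (Fin 3) ℂ) := by
    funext k
    exact apply_coe_congrT L 3 α α' w T hcongr Θ k
  rw [hcomp] at hI
  rw [hI]
  exact key

end Transport

/-! ## §3 The equality of the two pinned constants (CM field: ★ p841778 uniqueness on the target frame) -/

section CM

variable (L : Type) [Field L] [NumberField L] [IsCMField L] (α α' : Fin 3 → L) (w : {w : InfinitePlace L // IsComplex w}) (T : GL (Fin 3) ℂ)
  (hcongr : formCongr (starRingEnd ℂ) T ((Matrix.diagonal α').map w.1.embedding) = (Matrix.diagonal α).map w.1.embedding)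
  (htorus : ∀ z : Fin 3 → Circle, T * circleDiagonal 3 z * T⁻¹ = circleDiagonal 3 z)

include htorus in
/-- **(R1-d)(b2′) CROSS-FRAME COHERENCE ALONG A TORUS-FIXING CONGRUENCE**: for a CM field, if `c₁` satisfies the (J-nc) clause on `G_w(α′)` (frame guards `hα′`, `hreal′`) for the datum
`(ν′, z₁, ν_H′)` TRANSPORTED from `(ν, z₁, ν_H)` on `G_w(α)` along `e_T`, and `c₂` satisfies it on `G_w(α)` for `(ν, z₁, ν_H)`, then `c₁ = c₂` (§2 + ★ p841778
`archLimitFormulaNoncompactWall_const_unique` on `G_w(α′)`). [cite: Rogawski1990, §8.2 pp. 119, 122–124; §8.4 pp. 126–127] [cite: Varadarajan1989, §6.4 Thm 22] -/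
theorem archLimitFormulaNoncompactWall_const_eq_of_transport_of_torusFixing
    [LocallyCompactSpace (archLocal L 3 (Matrix.diagonal α) w)] [SecondCountableTopology (archLocal L 3 (Matrix.diagonal α) w)] [MeasurableSpace (archLocal L 3 (Matrix.diagonal α) w)] [BorelSpace (archLocal L 3 (Matrix.diagonal α) w)]
    [LocallyCompactSpace (archLocal L 3 (Matrix.diagonal α') w)] [SecondCountableTopology (archLocal L 3 (Matrix.diagonal α') w)] [MeasurableSpace (archLocal L 3 (Matrix.diagonal α') w)] [BorelSpace (archLocal L 3 (Matrix.diagonal α') w)]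
    (hα' : ∀ i, α' i ≠ 0) (hreal' : ∀ i, (w.1.embedding (α' i)).im = 0)
    (ν : Measure (archLocal L 3 (Matrix.diagonal α) w)) [ν.IsHaarMeasure] [ν.IsMulRightInvariant]
    (ν' : Measure (archLocal L 3 (Matrix.diagonal α') w)) [ν'.IsHaarMeasure] [ν'.IsMulRightInvariant]
    (hν' : ν' = ν.map (ContinuousMulEquiv.restrictSubgroup (GLn.conjEquiv T) (archLocal L 3 (Matrix.diagonal α) w) (archLocal L 3 (Matrix.diagonal α') w)
        (mem_archLocal_diagonal_iff_conjEquiv_mem_of_formCongr_eq L 3 α α' w T hcongr)))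
    (z₁ : Fin 3 → Circle) (h02 : z₁ 0 = z₁ 2) (h01 : z₁ 0 ≠ z₁ 1)
    (νH : Measure (Subgroup.centralizer ({(⟨circleDiagonal 3 z₁, circleDiagonal_mem_archLocal_diagonal L 3 α w z₁⟩ : archLocal L 3 (Matrix.diagonal α) w)} : Set (archLocal L 3 (Matrix.diagonal α) w)))) [νH.IsHaarMeasure] [νH.IsInvInvariant]
    (νH' : Measure (Subgroup.centralizer ({(⟨circleDiagonal 3 z₁, circleDiagonal_mem_archLocal_diagonal L 3 α' w z₁⟩ : archLocal L 3 (Matrix.diagonal α') w)} : Set (archLocal L 3 (Matrix.diagonal α') w)))) [νH'.IsHaarMeasure] [νH'.IsInvInvariant]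
    (hνH' : νH' = νH.map (subgroupCongrHomeomorph (ContinuousMulEquiv.restrictSubgroup (GLn.conjEquiv T) (archLocal L 3 (Matrix.diagonal α) w) (archLocal L 3 (Matrix.diagonal α') w)
        (mem_archLocal_diagonal_iff_conjEquiv_mem_of_formCongr_eq L 3 α α' w T hcongr)).toMulEquiv
      (Subgroup.centralizer ({(⟨circleDiagonal 3 z₁, circleDiagonal_mem_archLocal_diagonal L 3 α w z₁⟩ : archLocal L 3 (Matrix.diagonal α) w)} : Set (archLocal L 3 (Matrix.diagonal α) w)))
      (Subgroup.centralizer ({(⟨circleDiagonal 3 z₁, circleDiagonal_mem_archLocal_diagonal L 3 α' w z₁⟩ : archLocal L 3 (Matrix.diagonal α') w)} : Set (archLocal L 3 (Matrix.diagonal α') w)))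
      (forall_apply_mem_centralizer_singleton_iff_of_eq (ContinuousMulEquiv.restrictSubgroup (GLn.conjEquiv T) (archLocal L 3 (Matrix.diagonal α) w) (archLocal L 3 (Matrix.diagonal α') w)
        (mem_archLocal_diagonal_iff_conjEquiv_mem_of_formCongr_eq L 3 α α' w T hcongr)).toMulEquiv (congrT_circleDiagonal L 3 α α' w T hcongr htorus z₁))
      (ContinuousMulEquiv.restrictSubgroup (GLn.conjEquiv T) (archLocal L 3 (Matrix.diagonal α) w) (archLocal L 3 (Matrix.diagonal α') w)
        (mem_archLocal_diagonal_iff_conjEquiv_mem_of_formCongr_eq L 3 α α' w T hcongr)).continuous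
      (ContinuousMulEquiv.restrictSubgroup (GLn.conjEquiv T) (archLocal L 3 (Matrix.diagonal α) w) (archLocal L 3 (Matrix.diagonal α') w)
        (mem_archLocal_diagonal_iff_conjEquiv_mem_of_formCongr_eq L 3 α α' w T hcongr)).symm.continuous))
    [MeasurableSpace (archLocal L 3 (Matrix.diagonal α) w ⧸ Subgroup.centralizer ({(⟨circleDiagonal 3 z₁, circleDiagonal_mem_archLocal_diagonal L 3 α w z₁⟩ : archLocal L 3 (Matrix.diagonal α) w)} : Set (archLocal L 3 (Matrix.diagonal α) w)))]
    [BorelSpace (archLocal L 3 (Matrix.diagonal α) w ⧸ Subgroup.centralizer ({(⟨circleDiagonal 3 z₁, circleDiagonal_mem_archLocal_diagonal L 3 α w z₁⟩ : archLocal L 3 (Matrix.diagonal α) w)} : Set (archLocal L 3 (Matrix.diagonal α) w)))]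
    [MeasurableSpace (archLocal L 3 (Matrix.diagonal α') w ⧸ Subgroup.centralizer ({(⟨circleDiagonal 3 z₁, circleDiagonal_mem_archLocal_diagonal L 3 α' w z₁⟩ : archLocal L 3 (Matrix.diagonal α') w)} : Set (archLocal L 3 (Matrix.diagonal α') w)))]
    [BorelSpace (archLocal L 3 (Matrix.diagonal α') w ⧸ Subgroup.centralizer ({(⟨circleDiagonal 3 z₁, circleDiagonal_mem_archLocal_diagonal L 3 α' w z₁⟩ : archLocal L 3 (Matrix.diagonal α') w)} : Set (archLocal L 3 (Matrix.diagonal α') w)))]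
    {c₁ c₂ : ℂ}
    (h₁ : ∀ (Θ : Matrix (Fin 3) (Fin 3) ℂ → ℂ), ContDiff ℝ (⊤ : ℕ∞) Θ →
        HasCompactSupport (fun k : archLocal L 3 (Matrix.diagonal α') w => Θ ((k : GL (Fin 3) ℂ) : Matrix (Fin 3) (Fin 3) ℂ)) →
        ∀ (z₀ : Fin 3 → Circle) (h02' : z₀ 0 = z₀ 2) (h01' : z₀ 0 ≠ z₀ 1),
          Tendsto (fun ψ : ℝ => deriv (fun ψ : ℝ => (2 * Real.sin ψ : ℂ) *
              ∫ g, Θ (((g * ⟨circleDiagonal 3 (fun i => z₀ i * Circle.exp (![(1 : ℝ), 0, -1] i * ψ)),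
                circleDiagonal_mem_archLocal_diagonal L 3 α' w _⟩ * g⁻¹ : archLocal L 3 (Matrix.diagonal α') w) : GL (Fin 3) ℂ) : Matrix (Fin 3) (Fin 3) ℂ) ∂ν') ψ)
            (𝓝[≠] 0)
            (𝓝 (c₁ * ∫ y, descConj (⟨circleDiagonal 3 z₀, circleDiagonal_mem_archLocal_diagonal L 3 α' w z₀⟩ : archLocal L 3 (Matrix.diagonal α') w)
              (Subgroup.centralizer ({(⟨circleDiagonal 3 z₁, circleDiagonal_mem_archLocal_diagonal L 3 α' w z₁⟩ : archLocal L 3 (Matrix.diagonal α') w)} : Set (archLocal L 3 (Matrix.diagonal α') w)))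
              (forall_mem_centralizer_circleDiagonal_comm_of_wall L α' w h02 h01 h02' h01')
              (fun k : archLocal L 3 (Matrix.diagonal α') w => Θ ((k : GL (Fin 3) ℂ) : Matrix (Fin 3) (Fin 3) ℂ)) y
              ∂(quotientMeasure _ νH' (isClosed_coe_centralizer_singleton _) ν'))))
    (h₂ : ∀ (Θ : Matrix (Fin 3) (Fin 3) ℂ → ℂ), ContDiff ℝ (⊤ : ℕ∞) Θ →
        HasCompactSupport (fun k : archLocal L 3 (Matrix.diagonal α) w => Θ ((k : GL (Fin 3) ℂ) : Matrix (Fin 3) (Fin 3) ℂ)) →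
        ∀ (z₀ : Fin 3 → Circle) (h02' : z₀ 0 = z₀ 2) (h01' : z₀ 0 ≠ z₀ 1),
          Tendsto (fun ψ : ℝ => deriv (fun ψ : ℝ => (2 * Real.sin ψ : ℂ) *
              ∫ g, Θ (((g * ⟨circleDiagonal 3 (fun i => z₀ i * Circle.exp (![(1 : ℝ), 0, -1] i * ψ)),
                circleDiagonal_mem_archLocal_diagonal L 3 α w _⟩ * g⁻¹ : archLocal L 3 (Matrix.diagonal α) w) : GL (Fin 3) ℂ) : Matrix (Fin 3) (Fin 3) ℂ) ∂ν) ψ)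
            (𝓝[≠] 0)
            (𝓝 (c₂ * ∫ y, descConj (⟨circleDiagonal 3 z₀, circleDiagonal_mem_archLocal_diagonal L 3 α w z₀⟩ : archLocal L 3 (Matrix.diagonal α) w)
              (Subgroup.centralizer ({(⟨circleDiagonal 3 z₁, circleDiagonal_mem_archLocal_diagonal L 3 α w z₁⟩ : archLocal L 3 (Matrix.diagonal α) w)} : Set (archLocal L 3 (Matrix.diagonal α) w)))
              (forall_mem_centralizer_circleDiagonal_comm_of_wall L α w h02 h01 h02' h01')
              (fun k : archLocal L 3 (Matrix.diagonal α) w => Θ ((k : GL (Fin 3) ℂ) : Matrix (Fin 3) (Fin 3) ℂ)) y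
              ∂(quotientMeasure _ νH (isClosed_coe_centralizer_singleton _) ν)))) :
    c₁ = c₂ :=
  archLimitFormulaNoncompactWall_const_unique L α' w hα' hreal' ν' h02 h01 νH' h₁
    (archLimitFormulaNoncompactWall_clause_transport_of_torusFixing L α α' w T hcongr htorus ν ν' hν' z₁ h02 h01 νH νH' hνH' c₂ h₂)

end CM

end Literature.NumberTheory.Rogawski1990

end
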